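import Summits.PneNP.PneNP.Theorems.ChebyshevTracialDesignVirtualNonnegSpread
import Summits.PneNP.PneNP.Theorems.ChebyshevTracialDesignSpectralNonTightness
import Summits.PneNP.PneNP.Theorems.ChebyshevTracialDesignLayerRatioSharp
import Literature.Combinatorics.Additive.LevelDInequalitySn
import HarnessLib

/-!
# Cell pnp-psdrank, route `ChebyshevTracialDesign`: VIRTUAL LEVEL = TIGHT LEVEL — the design value of a dense × homogeneous-dense rectangle is
# MINUS ITS NORMALISED TIGHT MASS, two-sidedly, up to `16μν/n` and the two tails (crux `TracialDecayExp20`, stmt-PneNP-19878)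

Brick 175 (prover g34; MEMO-37 §3). VNS (brick 46, `…VirtualNonnegSpread.spreadCell_value_le_of_globalLevelD`) is ONE-sided: the virtual value
of a dense spread cell is `≥ (3/7)μν`, hence its design value is `≤ B√(P_D μν)`. The mode budget behind it is finer than that. Write
`c_κ = T_{2κ}(X,Y)/(|PM|·N₁)` for the normalised TIGHT layer correlations (bricks 25–27) and `R_κ = 1 + ρ_{2κ}` for the layer ratio
(brick 44b). Then
* brick 19: `|V(X×Y) + Virt_D(X×Y)| ≤ B√(P_D μν)` (the design reads the low virtual value);
* brick 45: `Virt_D = μν + Σ_{1≤κ≤D/2} R_κ c_κ`;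
* §1 HERE (`tightDensity_eq`, brick 25's tight-pair expansion for an ARBITRARY rectangle, odd layers removed, normalised):
  `Tight(X×Y) := #{(U,M) ∈ X×Y : cc(U,M) = 1}/(|PM|·N₁) = μν + Σ_{1≤κ≤c'} c_κ`;
so `Virt_D − Tight = Σ_{κ≤D/2} ρ_{2κ} c_κ − Σ_{D/2<κ≤c'} c_κ`, and brick 174 gives `ρ_{2κ} ≤ 28κ/n` (§2 `layerRatio_le_one_add_div'`, the `n ≤ 5t`
form of brick 174 §3). Hence:
* §3 **`value_add_tight_abs_le_of_layerBounds`** (design-free in the families): for an exact design of degree `D` (`D + 2 ≤ 2c'`, `14D ≤ n`,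
  `2t ≤ n ≤ 5t`) and a rectangle whose head modes obey SNT's estimate `|c_κ| ≤ 4μν·16^{−κ}` (`κ ≤ D/2`) and whose high modes obey `|c_κ| ≤ θ`
  (`D/2 < κ ≤ c'`): `|V(X×Y) + Tight(X×Y)| ≤ B·√(P_D μν) + 16μν/n + c'·θ`;
* §4 **`value_add_tight_abs_le_of_spread`** — UNCONDITIONAL (`GlobalLevelDInequality_holds`): for `τ ≥ 1` there are `c₀ > 0`, `n₁` such that
  for even `n ≥ n₁`, every exact design `(n, t = 2c'+1, T, D, B, C, w)` with `n ≤ 5t`, `D + 2 ≤ 2c'`, `D ≤ 2(dq n + 8)`, `14D ≤ n`, every family `X`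
  of `t`-subsets of density `μ ≥ e^{−c₀·dq n}` and every `(PM_n, τ)`-homogeneous `Y` of density `ν ≥ e^{−c₀·dq n}`:
  `|V(X×Y) + Tight(X×Y)| ≤ B·√(P_D μν) + 16μν/n + c'·√(μν·A_{D/2+1})`, `A_m = Π_{i<m}(2i+1)/(n−2i)` the tight attenuation (brick 28's
  `tail_term_le` for the high modes). For the crux's designs (`D ≍ dq n ≍ n^{1/4}`) both tails are `e^{−Ω(n^{1/4} log n)}·√(μν)`, so
  THE DESIGN VALUE OF A SPREAD CELL IS `−Tight(X×Y)·(1 ± o(1)) ± 16μν/n`: negative by exactly the honest tight mass, and in particular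
  two-sided. VNS is the corollary `V ≤ tails` (`Tight ≥ 0`); the new content is the LOWER bound `V ≥ −Tight − tails − 16μν/n` and the
  identification of the virtual value with an honest conditional expectation at the tight level (`cc = 1`), which is what kit j333539 sees
  for the per-cut tilted second moments of MEMO-36's open instance (relative virtual/tight discrepancy `6·10⁻⁴` at `n = 400`).
[cite: Rothvoss2017, §2 (PDF p. 6)] [cite: Grigoriev2001, Lemma 1.4 (PDF p. 8)] [cite: KeevashLifshitz2023, Thm. 1.8]
[cite: KupavskiiZakharov2022, §2] [cite: BrouwerHaemers2012, Prop. 4.3.2 (PDF p. 83)] [cite: GodsilMeagher2015, §15.2]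
Stature: support/instrument (kernel lane, no defs, axioms standard; a two-sided sharpening of VNS from bricks 19/25/27/28/44/45/46/174).
WHAT THIS IS NOT: not the second-moment (reweighted) version that (PC-ν) needs (MEMO-37 §3(d), OPEN), no proof or refutation of
`TracialDecayExp20`, nothing on psd rank of P_PM(K_n) beyond the rungs, no P-vs-NP content. Supports stmt-PneNP-19878.
-/

set_option linter.dupNamespace false -- `Summit.PneNP.PneNP.…`: summit = sub-problem (D-0017)

noncomputable section

namespace Summit.PneNP.PneNP.Theorems.ChebyshevTracialDesignVirtualEqualsTight

open Finset Literature.Barriers.PneNP Literature.Computability.Complexity Literature.Combinatorics.Optimization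
open Literature.Combinatorics.AssociationSchemes Literature.Combinatorics.AssociationSchemes.JohnsonHarmonics
open Literature.Combinatorics.AssociationSchemes.JohnsonSpectrum
open Literature.Combinatorics.AssociationSchemes.HomogeneousMatchingFamilies
open Literature.Combinatorics.SetFamily
open Literature.Combinatorics.SimpleGraph.CycleSpace
open Literature.Combinatorics.Additive.KeevashLifshitz
open Summit.PneNP.PneNP.Theorems.ChebyshevTracialDesignTightFreeSpectral
open Summit.PneNP.PneNP.Theorems.ChebyshevTracialDesignTightColumnSums
open Summit.PneNP.PneNP.Theorems.ChebyshevTracialDesignProfilePolynomial (card_pmatch_pos)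
open Summit.PneNP.PneNP.Theorems.ChebyshevTracialDesignProfileExtrapolation (rectangle_value_truncation_explicit)
open Summit.PneNP.PneNP.Theorems.ChebyshevTracialDesignTightFreeLayers (tight_pairs_eq_sum_layerCorr layerCorr_zero_eq)
open Summit.PneNP.PneNP.Theorems.ChebyshevTracialDesignTightLayerBimode (layerCorr_eq_zero_of_odd)
open Summit.PneNP.PneNP.Theorems.ChebyshevTracialDesignSpectralNonTightnessLayers (filter_even_Ico_eq_map)
open Summit.PneNP.PneNP.Theorems.ChebyshevTracialDesignSpectralNonTightness (tail_term_le)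
open Summit.PneNP.PneNP.Theorems.ChebyshevTracialDesignVirtualLayerRatio (one_le_layerRatio)
open Summit.PneNP.PneNP.Theorems.ChebyshevTracialDesignLayerRatioSharp (layerRatio_le_one_add)
open Summit.PneNP.PneNP.Theorems.ChebyshevTracialDesignVirtualBimode (virtual_rectangle_eq)
open Summit.PneNP.PneNP.Theorems.ChebyshevTracialDesignVirtualNonnegSpread (head_layerBound_of_globalLevelD)

variable {n : ℕ}

/-! ### §1 The normalised tight mass of an arbitrary rectangle, layer by layer -/

/-- **The normalised tightness identity for an ARBITRARY rectangle.** For `n` even, `t = 2c'+1 ≤ n/2`, a family `X` of `t`-subsets with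
harmonic layer decomposition `p` of its indicator and any set `Y` of perfect matchings:
`#{(U,M) ∈ X×Y : cc(U,M) = 1}/(|PM_n|·N₁) = μ(X)ν(Y) + Σ_{κ=1}^{c'} T_{2κ}(X,Y)/(|PM_n|·N₁)` (brick 25's `tight_pairs_eq_sum_layerCorr` and
`layerCorr_zero_eq`, odd layers removed by brick 26; brick 27 recorded the tight-free case `0 = μν + Σ`).
[cite: Rothvoss2017, §2 (PDF p. 6)] [cite: BrouwerHaemers2012, Prop. 4.3.2 (PDF p. 83)] -/
theorem tightDensity_eq {c' : ℕ} (hn : Even n) (ht : 2 * (2 * c' + 1) ≤ n) (X : Finset (Finset (Fin n)))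
    (hX : X ⊆ univ.powersetCard (2 * c' + 1)) (Y : Finset (PMatch n)) (p : ℕ → Finset (Fin n) → ℝ)
    (hp : ∀ j, IsHarmonic j (p j))
    (hdec : ∀ U ∈ univ.powersetCard (2 * c' + 1),
      (if U ∈ X then (1 : ℝ) else 0) = (∑ j ∈ range (2 * c' + 1 + 1), up^[2 * c' + 1 - j] (p j)) U) :
    ((((X ×ˢ Y).filter fun UM : Finset (Fin n) × PMatch n =>
        (UM.1.filter fun x => UM.2.2.partner x ∉ UM.1).card = 1).card : ℕ) : ℝ) /
        ((Fintype.card (PMatch n) : ℝ) * ((((n / 2).choose (1 + c') * (1 + c').choose c' * 2 ^ 1 : ℕ) : ℝ))) =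
      ((X.card : ℝ) / (n.choose (2 * c' + 1) : ℝ)) * ((Y.card : ℝ) / (Fintype.card (PMatch n) : ℝ)) +
        ∑ κ ∈ Icc 1 c', (∑ M ∈ Y, ∑ U ∈ univ.powersetCard (2 * c' + 1),
            (up^[2 * c' + 1 - 2 * κ] (p (2 * κ))) U * (if (U.filter fun x => M.2.partner x ∉ U).card = 1 then (1 : ℝ) else 0)) /
          ((Fintype.card (PMatch n) : ℝ) * ((((n / 2).choose (1 + c') * (1 + c').choose c' * 2 ^ 1 : ℕ) : ℝ))) := by
  classical
  have htot := tight_pairs_eq_sum_layerCorr X hX Y p hdec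
  set PM : ℝ := (Fintype.card (PMatch n) : ℝ) with hPM
  set N1 : ℝ := ((((n / 2).choose (1 + c') * (1 + c').choose c' * 2 ^ 1 : ℕ) : ℝ)) with hN1
  have hPMpos : 0 < PM := by rw [hPM]; exact_mod_cast card_pmatch_pos hn
  have hN1pos : 0 < N1 := by
    rw [hN1]
    have h1 : 0 < (n / 2).choose (1 + c') := Nat.choose_pos (by omega)
    have h2 : 0 < (1 + c').choose c' := Nat.choose_pos (by omega)
    positivity
  rw [range_eq_Ico, ← Finset.sum_Ico_consecutive _ (Nat.zero_le 1) (by omega : 1 ≤ 2 * c' + 1 + 1),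
    show Ico 0 1 = {0} by rfl, sum_singleton, layerCorr_zero_eq (by omega) X hX Y p hp hdec] at htot
  -- remove the odd layers and reindex the even ones
  have hsum : ∑ j ∈ Ico 1 (2 * c' + 1 + 1), ∑ M ∈ Y, ∑ U ∈ univ.powersetCard (2 * c' + 1),
        (up^[2 * c' + 1 - j] (p j)) U * (if (U.filter fun x => M.2.partner x ∉ U).card = 1 then (1 : ℝ) else 0) =
      ∑ κ ∈ Icc 1 c', ∑ M ∈ Y, ∑ U ∈ univ.powersetCard (2 * c' + 1),
        (up^[2 * c' + 1 - 2 * κ] (p (2 * κ))) U * (if (U.filter fun x => M.2.partner x ∉ U).card = 1 then (1 : ℝ) else 0) := by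
    rw [← sum_filter_add_sum_filter_not (Ico 1 (2 * c' + 1 + 1)) (fun j => Even j), filter_even_Ico_eq_map c', sum_map]
    have hodd : ∑ j ∈ (Ico 1 (2 * c' + 1 + 1)).filter (fun j => ¬Even j), ∑ M ∈ Y, ∑ U ∈ univ.powersetCard (2 * c' + 1),
        (up^[2 * c' + 1 - j] (p j)) U * (if (U.filter fun x => M.2.partner x ∉ U).card = 1 then (1 : ℝ) else 0) = 0 := by
      refine sum_eq_zero fun j hj => ?_
      obtain ⟨hj1, hj2⟩ := mem_filter.1 hj
      exact layerCorr_eq_zero_of_odd ⟨c', rfl⟩ (Nat.not_even_iff_odd.1 hj2) (by have := (mem_Ico.1 hj1).2; omega) Y (hp j)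
    rw [hodd, add_zero]
    rfl
  rw [hsum] at htot
  rw [htot, ← sum_div, add_div]
  congr 1
  field_simp
  rw [hN1]
  ring

/-! ### §2 The layer ratio on the wider balanced slices `n ≤ 5t` -/

/-- **`ρ_{2κ} ≤ 28κ/n` for `2t ≤ n ≤ 5t`** (`t = 2a+1`, `28κ ≤ n`): the `n ≤ 5t` companion of brick 174's `layerRatio_le_one_add_div`
(`2a+2−2κ ≥ n/10`, `n−2a−2κ ≥ 2n/5`, so the `x` of brick 174 §2 is `≤ 14/n`). [cite: Grigoriev2001, Lemma 1.4 (PDF p. 8)]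
[cite: GodsilMeagher2015, §15.2] -/
theorem layerRatio_le_one_add_div' {a κ : ℕ} (ht : 2 * (2 * a + 1) ≤ n) (hbal : n ≤ 5 * (2 * a + 1)) (hκ : 28 * κ ≤ n) :
    ∏ i ∈ range κ, (((2 * a + 1 : ℝ) - 2 * i) * ((n : ℝ) - 2 * a - 1 - 2 * i) /
        (((2 * a : ℝ) - 2 * i) * ((n : ℝ) - 2 * a - 2 - 2 * i))) ≤ 1 + 28 * (κ : ℝ) / n := by
  rcases Nat.eq_zero_or_pos κ with hκ0 | hκpos
  · subst hκ0; simp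
  have hn0 : 0 < n := by omega
  have hnR : (0 : ℝ) < n := by exact_mod_cast hn0
  have hn28 : (28 : ℝ) ≤ n := by exact_mod_cast (le_trans (by omega : 28 ≤ 28 * κ) hκ)
  have hκa : κ ≤ a := by omega
  have hX : (n : ℝ) / 10 ≤ (2 * a + 2 : ℝ) - 2 * κ := by
    have h1 : (n : ℝ) ≤ 5 * (2 * a + 1) := by exact_mod_cast hbal
    have h2 : (28 * κ : ℝ) ≤ n := by exact_mod_cast hκ
    linarith
  have hY : 2 * (n : ℝ) / 5 ≤ (n : ℝ) - 2 * a - 2 * κ := by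
    have h1 : (2 * (2 * a + 1) : ℝ) ≤ n := by exact_mod_cast ht
    have h2 : (28 * κ : ℝ) ≤ n := by exact_mod_cast hκ
    linarith
  have hX0 : (0 : ℝ) < (2 * a + 2 : ℝ) - 2 * κ := by linarith [show (0:ℝ) < n / 10 by positivity]
  have hY0 : (0 : ℝ) < (n : ℝ) - 2 * a - 2 * κ := by linarith [show (0:ℝ) < 2 * n / 5 by positivity]
  set x : ℝ := 1 / ((2 * a + 2 : ℝ) - 2 * κ) + 1 / ((n : ℝ) - 2 * a - 2 * κ) +
      1 / (((2 * a + 2 : ℝ) - 2 * κ) * ((n : ℝ) - 2 * a - 2 * κ)) with hxdef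
  have h1 : 1 / ((2 * a + 2 : ℝ) - 2 * κ) ≤ 10 / n := by
    rw [div_le_div_iff₀ hX0 hnR]; linarith
  have h2 : 1 / ((n : ℝ) - 2 * a - 2 * κ) ≤ 5 / (2 * n) := by
    rw [div_le_div_iff₀ hY0 (by positivity)]; linarith
  have h3 : 1 / (((2 * a + 2 : ℝ) - 2 * κ) * ((n : ℝ) - 2 * a - 2 * κ)) ≤ 25 / ((n : ℝ) ^ 2) := by
    rw [div_le_div_iff₀ (mul_pos hX0 hY0) (by positivity)]
    have := mul_le_mul hX hY (by positivity) hX0.le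
    nlinarith
  have hx14 : x ≤ 14 / n := by
    have h4 : 25 / ((n : ℝ) ^ 2) ≤ 1 / n := by
      rw [div_le_div_iff₀ (by positivity) hnR]; nlinarith [hn28, hnR]
    have h5 : (10 : ℝ) / n + 5 / (2 * n) + 1 / n ≤ 14 / n := by
      rw [div_add_div _ _ hnR.ne' (by positivity), div_add_div _ _ (by positivity) hnR.ne', div_le_div_iff₀ (by positivity) hnR]
      nlinarith
    calc x ≤ 10 / n + 5 / (2 * n) + 1 / n := by rw [hxdef]; linarith
      _ ≤ 14 / n := h5
  have hκx : 2 * (κ : ℝ) * x ≤ 1 := by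
    have hκR : (28 * κ : ℝ) ≤ n := by exact_mod_cast hκ
    calc 2 * (κ : ℝ) * x ≤ 2 * κ * (14 / n) := mul_le_mul_of_nonneg_left hx14 (by positivity)
      _ = 28 * κ / n := by ring
      _ ≤ 1 := by rw [div_le_one hnR]; exact hκR
  have hmain := layerRatio_le_one_add (n := n) ht hκa (by rw [← hxdef]; exact hκx)
  rw [← hxdef] at hmain
  refine hmain.trans ?_
  have hκ0 : (0 : ℝ) ≤ κ := Nat.cast_nonneg _
  calc 1 + 2 * (κ : ℝ) * x ≤ 1 + 2 * κ * (14 / n) := by nlinarith [mul_le_mul_of_nonneg_left hx14 (by positivity : (0:ℝ) ≤ 2 * κ)]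
    _ = 1 + 28 * (κ : ℝ) / n := by ring

/-- `κ·16^{−κ} ≤ 8^{−κ}` (`κ ≤ 2^κ`). -/
theorem mul_sixteenth_pow_le (κ : ℕ) : (κ : ℝ) * (1 / 16 : ℝ) ^ κ ≤ (1 / 8 : ℝ) ^ κ := by
  have h1 : (κ : ℝ) ≤ (2 : ℝ) ^ κ := by exact_mod_cast (Nat.lt_two_pow_self).le
  have h2 : ((1 : ℝ) / 8) ^ κ = (2 : ℝ) ^ κ * (1 / 16) ^ κ := by rw [← mul_pow]; norm_num
  rw [h2]
  exact mul_le_mul_of_nonneg_right h1 (by positivity)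

/-! ### §3 Virtual = tight, abstract layer-bound form -/

/-- **THE DESIGN VALUE OF A RECTANGLE IS MINUS ITS TIGHT MASS, given SNT's layer bounds** (design-free in `X, Y`). For `n` even, an exact
design `(n, t = 2c'+1, T, D, B, C, w)` with `D + 2 ≤ 2c'`, `n ≤ 5t`, `14D ≤ n`, a family `X` of `t`-subsets (harmonic layers `p` of `1_X`, densities
`μ, ν`) and a set `Y` of perfect matchings whose normalised tight layer correlations `c_κ = T_{2κ}(X,Y)/(|PM|·N₁)` satisfy the head estimate
`|c_κ| ≤ 4μν·16^{−κ}` for `1 ≤ κ ≤ D/2` and `|c_κ| ≤ θ` for `D/2 < κ ≤ c'`: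
`|Σ_{U.1∈X} Σ_{M∈Y} W(U,M) + #{(U,M) ∈ X×Y : cc = 1}/(|PM|·N₁)| ≤ B·√(P_D μν) + 16μν/n + c'·θ`.
Mechanism: brick 19 (`V = −Virt_D ± B√(P_Dμν)`), brick 45 (`Virt_D = μν + Σ_{κ≤D/2} R_κ c_κ`), §1 (`Tight = μν + Σ_{κ≤c'} c_κ`), §2
(`0 ≤ R_κ − 1 ≤ 28κ/n`), `Σ_κ 28κ·4·16^{−κ} ≤ 112·Σ_κ 8^{−κ} ≤ 16`. [cite: Rothvoss2017, §2 (PDF p. 6)] [cite: Grigoriev2001, Lemma 1.4 (PDF p. 8)]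
[cite: BrouwerHaemers2012, Prop. 4.3.2 (PDF p. 83)] -/
theorem value_add_tight_abs_le_of_layerBounds {c' T D : ℕ} {Bv θ : ℝ} {C : Finset ℕ} {w : ℕ → ℝ} (hn : Even n)
    (hdes : IsExactDesign n (2 * c' + 1) T D Bv C w) (hD : D + 2 ≤ 2 * c') (hbal : n ≤ 5 * (2 * c' + 1)) (hDn : 14 * D ≤ n)
    (hθ : 0 ≤ θ)
    (X : Finset (Finset (Fin n))) (hX : X ⊆ univ.powersetCard (2 * c' + 1)) (Y : Finset (PMatch n))
    (p : ℕ → Finset (Fin n) → ℝ) (hp : ∀ j, IsHarmonic j (p j))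
    (hdec : ∀ U ∈ univ.powersetCard (2 * c' + 1),
      (if U ∈ X then (1 : ℝ) else 0) = (∑ j ∈ range (2 * c' + 1 + 1), up^[2 * c' + 1 - j] (p j)) U)
    (hhead : ∀ κ ∈ Icc 1 (D / 2),
      |∑ M ∈ Y, ∑ U ∈ univ.powersetCard (2 * c' + 1),
          (up^[2 * c' + 1 - 2 * κ] (p (2 * κ))) U * (if (U.filter fun x => M.2.partner x ∉ U).card = 1 then (1 : ℝ) else 0)| /
          ((Fintype.card (PMatch n) : ℝ) * ((((n / 2).choose (1 + c') * (1 + c').choose c' * 2 ^ 1 : ℕ) : ℝ))) ≤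
        4 * ((X.card : ℝ) / (n.choose (2 * c' + 1) : ℝ)) * ((Y.card : ℝ) / (Fintype.card (PMatch n) : ℝ)) * (1 / 16) ^ κ)
    (htail : ∀ κ ∈ Icc (D / 2 + 1) c',
      |∑ M ∈ Y, ∑ U ∈ univ.powersetCard (2 * c' + 1),
          (up^[2 * c' + 1 - 2 * κ] (p (2 * κ))) U * (if (U.filter fun x => M.2.partner x ∉ U).card = 1 then (1 : ℝ) else 0)| /
          ((Fintype.card (PMatch n) : ℝ) * ((((n / 2).choose (1 + c') * (1 + c').choose c' * 2 ^ 1 : ℕ) : ℝ))) ≤ θ) :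
    |∑ U : OddSet n, ∑ M ∈ Y, levelWeight n (2 * c' + 1) C w U M * (if U.1 ∈ X then (1 : ℝ) else 0) +
        ((((X ×ˢ Y).filter fun UM : Finset (Fin n) × PMatch n =>
            (UM.1.filter fun x => UM.2.2.partner x ∉ UM.1).card = 1).card : ℕ) : ℝ) /
          ((Fintype.card (PMatch n) : ℝ) * ((((n / 2).choose (1 + c') * (1 + c').choose c' * 2 ^ 1 : ℕ) : ℝ)))| ≤
      Bv * Real.sqrt ((∏ i ∈ range (D / 2 + 1), ((2 * i + 1 : ℝ) / ((n : ℝ) - 2 * i))) *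
          ((X.card : ℝ) / (n.choose (2 * c' + 1) : ℝ)) * ((Y.card : ℝ) / (Fintype.card (PMatch n) : ℝ))) +
        16 * (((X.card : ℝ) / (n.choose (2 * c' + 1) : ℝ)) * ((Y.card : ℝ) / (Fintype.card (PMatch n) : ℝ))) / n +
        (c' : ℝ) * θ := by
  classical
  have ht2 : 2 * (2 * c' + 1) + 2 ≤ n := hdes.2.1
  have ht : 2 * (2 * c' + 1) ≤ n := by omega
  have hn0 : (0 : ℝ) < n := by exact_mod_cast (show 0 < n by omega)
  have htrunc := rectangle_value_truncation_explicit hn hdes (by omega) X hX Y p hp hdec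
  have hvirt := virtual_rectangle_eq hn ht (by omega : D ≤ 2 * c') X hX Y p hp hdec
  have htight := tightDensity_eq hn ht X hX Y p hp hdec
  set μ : ℝ := (X.card : ℝ) / (n.choose (2 * c' + 1) : ℝ) with hμ
  set ν : ℝ := (Y.card : ℝ) / (Fintype.card (PMatch n) : ℝ) with hν
  set PN : ℝ := (Fintype.card (PMatch n) : ℝ) * ((((n / 2).choose (1 + c') * (1 + c').choose c' * 2 ^ 1 : ℕ) : ℝ)) with hPN
  set cκ : ℕ → ℝ := fun κ => (∑ M ∈ Y, ∑ U ∈ univ.powersetCard (2 * c' + 1),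
      (up^[2 * c' + 1 - 2 * κ] (p (2 * κ))) U * (if (U.filter fun x => M.2.partner x ∉ U).card = 1 then (1 : ℝ) else 0)) / PN
    with hcκ
  set R : ℕ → ℝ := fun κ => ∏ i ∈ range κ, (((2 * c' + 1 : ℝ) - 2 * i) * ((n : ℝ) - 2 * c' - 1 - 2 * i) /
      (((2 * c' : ℝ) - 2 * i) * ((n : ℝ) - 2 * c' - 2 - 2 * i))) with hR
  have hμ0 : 0 ≤ μ := by positivity
  have hν0 : 0 ≤ ν := by positivity
  have hPN0 : 0 < PN := by
    rw [hPN]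
    have h1 : 0 < (n / 2).choose (1 + c') := Nat.choose_pos (by omega)
    have h2 : 0 < (1 + c').choose c' := Nat.choose_pos (by omega)
    have h3 := card_pmatch_pos hn
    positivity
  -- `|c_κ|` in terms of the hypotheses
  have habs : ∀ κ, |cκ κ| = |∑ M ∈ Y, ∑ U ∈ univ.powersetCard (2 * c' + 1),
      (up^[2 * c' + 1 - 2 * κ] (p (2 * κ))) U * (if (U.filter fun x => M.2.partner x ∉ U).card = 1 then (1 : ℝ) else 0)| / PN := by
    intro κ; rw [hcκ]; simp only; rw [abs_div, abs_of_pos hPN0]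
  -- the virtual sum in mode form, and its distance to the tight mass
  have hvirt' : (Fintype.card (PMatch n) : ℝ)⁻¹ * ∑ M ∈ Y, ∑ A : {A : Finset (Fin n) // A.card ≤ D},
        (∑ j ∈ range (2 * c' + 1 + 1), ((2 * c' + 1 - j).factorial : ℝ) • (if D < j then 0 else p j)) A.1 *
          knapsackMoment M.1.card (((2 * c' + 1 : ℕ) : ℝ) / 2) (M.1.filter fun e => ∃ a ∈ A.1, a ∈ e).card =
      μ * ν + ∑ κ ∈ Icc 1 (D / 2), R κ * cκ κ := by
    rw [hvirt]
  have htight' : ((((X ×ˢ Y).filter fun UM : Finset (Fin n) × PMatch n =>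
        (UM.1.filter fun x => UM.2.2.partner x ∉ UM.1).card = 1).card : ℕ) : ℝ) / PN = μ * ν + ∑ κ ∈ Icc 1 c', cκ κ := by
    rw [hPN, htight]
  -- split the tight sum at `D/2`
  have hsplit : ∑ κ ∈ Icc 1 c', cκ κ = ∑ κ ∈ Icc 1 (D / 2), cκ κ + ∑ κ ∈ Icc (D / 2 + 1) c', cκ κ := by
    have hIcc : Icc 1 c' = Icc 1 (D / 2) ∪ Icc (D / 2 + 1) c' := by
      ext κ; simp only [mem_union, mem_Icc]; omega
    have hdisj : Disjoint (Icc 1 (D / 2)) (Icc (D / 2 + 1) c') := by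
      rw [disjoint_left]; intro κ h1 h2; simp only [mem_Icc] at h1 h2; omega
    rw [hIcc, sum_union hdisj]
  -- the ρ-part
  have hrho : |∑ κ ∈ Icc 1 (D / 2), (R κ - 1) * cκ κ| ≤ 16 * (μ * ν) / n := by
    have hterm : ∀ κ ∈ Icc 1 (D / 2), |(R κ - 1) * cκ κ| ≤ (112 * (μ * ν) / n) * (1 / 8 : ℝ) ^ κ := by
      intro κ hκ
      obtain ⟨hκ1, hκD⟩ := mem_Icc.1 hκ
      have hR1 : 1 ≤ R κ := by rw [hR]; exact one_le_layerRatio (n := n) ht (by omega)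
      have hR2 : R κ ≤ 1 + 28 * (κ : ℝ) / n := by
        rw [hR]; exact layerRatio_le_one_add_div' (n := n) ht hbal (by omega)
      have hc : |cκ κ| ≤ 4 * μ * ν * (1 / 16) ^ κ := by rw [habs]; exact hhead κ hκ
      rw [abs_mul, abs_of_nonneg (by linarith)]
      calc (R κ - 1) * |cκ κ| ≤ (28 * (κ : ℝ) / n) * (4 * μ * ν * (1 / 16) ^ κ) :=
            mul_le_mul (by linarith) hc (abs_nonneg _) (by positivity)
        _ = (112 * (μ * ν) / n) * ((κ : ℝ) * (1 / 16) ^ κ) := by ring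
        _ ≤ (112 * (μ * ν) / n) * (1 / 8 : ℝ) ^ κ := mul_le_mul_of_nonneg_left (mul_sixteenth_pow_le κ) (by positivity)
    have hgeom : ∑ κ ∈ Icc 1 (D / 2), ((1 : ℝ) / 8) ^ κ ≤ 1 / 7 := by
      have hsub : Icc 1 (D / 2) ⊆ Ico 1 (D / 2 + 1) := by
        intro κ hκ; rw [mem_Ico]; have := mem_Icc.1 hκ; omega
      calc ∑ κ ∈ Icc 1 (D / 2), ((1 : ℝ) / 8) ^ κ ≤ ∑ κ ∈ Ico 1 (D / 2 + 1), ((1 : ℝ) / 8) ^ κ :=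
            sum_le_sum_of_subset_of_nonneg hsub fun κ _ _ => by positivity
        _ ≤ ((1 : ℝ) / 8) ^ 1 / (1 - 1 / 8) := geom_sum_Ico_le_of_lt_one (by norm_num) (by norm_num)
        _ ≤ 1 / 7 := by norm_num
    calc |∑ κ ∈ Icc 1 (D / 2), (R κ - 1) * cκ κ| ≤ ∑ κ ∈ Icc 1 (D / 2), |(R κ - 1) * cκ κ| := abs_sum_le_sum_abs _ _
      _ ≤ ∑ κ ∈ Icc 1 (D / 2), (112 * (μ * ν) / n) * (1 / 8 : ℝ) ^ κ := sum_le_sum hterm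
      _ = (112 * (μ * ν) / n) * ∑ κ ∈ Icc 1 (D / 2), (1 / 8 : ℝ) ^ κ := by rw [mul_sum]
      _ ≤ (112 * (μ * ν) / n) * (1 / 7) := mul_le_mul_of_nonneg_left hgeom (by positivity)
      _ = 16 * (μ * ν) / n := by ring
  -- the high modes
  have hhigh : |∑ κ ∈ Icc (D / 2 + 1) c', cκ κ| ≤ (c' : ℝ) * θ := by
    calc |∑ κ ∈ Icc (D / 2 + 1) c', cκ κ| ≤ ∑ κ ∈ Icc (D / 2 + 1) c', |cκ κ| := abs_sum_le_sum_abs _ _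
      _ ≤ ∑ κ ∈ Icc (D / 2 + 1) c', θ := sum_le_sum fun κ hκ => by rw [habs]; exact htail κ hκ
      _ = ((Icc (D / 2 + 1) c').card : ℝ) * θ := by rw [sum_const, nsmul_eq_mul]
      _ ≤ (c' : ℝ) * θ := by
          refine mul_le_mul_of_nonneg_right ?_ hθ
          have : (Icc (D / 2 + 1) c').card ≤ c' := by rw [Nat.card_Icc]; omega
          exact_mod_cast this
  -- assemble
  have hdiff : (Fintype.card (PMatch n) : ℝ)⁻¹ * ∑ M ∈ Y, ∑ A : {A : Finset (Fin n) // A.card ≤ D},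
        (∑ j ∈ range (2 * c' + 1 + 1), ((2 * c' + 1 - j).factorial : ℝ) • (if D < j then 0 else p j)) A.1 *
          knapsackMoment M.1.card (((2 * c' + 1 : ℕ) : ℝ) / 2) (M.1.filter fun e => ∃ a ∈ A.1, a ∈ e).card -
      ((((X ×ˢ Y).filter fun UM : Finset (Fin n) × PMatch n =>
        (UM.1.filter fun x => UM.2.2.partner x ∉ UM.1).card = 1).card : ℕ) : ℝ) / PN =
      ∑ κ ∈ Icc 1 (D / 2), (R κ - 1) * cκ κ - ∑ κ ∈ Icc (D / 2 + 1) c', cκ κ := by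
    rw [hvirt', htight', hsplit]
    have : ∑ κ ∈ Icc 1 (D / 2), (R κ - 1) * cκ κ = ∑ κ ∈ Icc 1 (D / 2), R κ * cκ κ - ∑ κ ∈ Icc 1 (D / 2), cκ κ := by
      rw [← sum_sub_distrib]; exact sum_congr rfl fun κ _ => by ring
    rw [this]; ring
  have key : ∀ (V Vt Tt : ℝ) (tail : ℝ), |V + Vt| ≤ tail → |Vt - Tt| ≤ 16 * (μ * ν) / n + c' * θ →
      |V + Tt| ≤ tail + 16 * (μ * ν) / n + c' * θ := by
    intro V Vt Tt tail h1 h2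
    have h3 : V + Tt = (V + Vt) - (Vt - Tt) := by ring
    rw [h3]
    exact (abs_sub _ _).trans (by linarith)
  refine key _ _ _ _ htrunc ?_
  rw [hdiff]
  exact (abs_sub _ _).trans (add_le_add hrho hhigh)

/-! ### §4 Virtual = tight for dense spread cells — unconditional -/

/-- **VIRTUAL = TIGHT FOR SPREAD CELLS — UNCONDITIONAL.** For `τ ≥ 1` there are `c₀ ∈ (0,1]` and `n₁` with: for `n ≥ n₁` even, every exact
design `(n, t = 2c'+1, T, D, B, C, w)` with `n ≤ 5t`, `D + 2 ≤ 2c'`, `D ≤ 2(dq n + 8)`, `14D ≤ n`, every family `X` of `t`-subsets with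
`μ = |X|/C(n,t) ≥ exp(−c₀ dq n)` and every `(PM_n, τ)`-homogeneous `Y` with `ν ≥ exp(−c₀ dq n)`:
`|Σ_{U.1∈X} Σ_{M∈Y} W(U,M) + #{(U,M) ∈ X×Y : cc(U,M) = 1}/(|PM|·N₁)| ≤ B·√(P_D μν) + 16μν/n + c'·√(μν·A_{D/2+1})`,
`P_D = Π_{i≤D/2}(2i+1)/(n−2i)`, `A_m = Π_{i<m}(2i+1)/(n−2i)` — the head modes by brick 46 (Keevash–Lifshitz, discharged by
`GlobalLevelDInequality_holds`), the high modes by brick 28's `tail_term_le`. The design value of a dense spread cell is minus its normalised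
tight mass up to `O(μν/n)` and two `e^{−Ω(D log n)}√(μν)` tails; VNS (`V ≤ B√(P_Dμν)`) is the one-sided shadow.
[cite: Rothvoss2017, §2 (PDF p. 6)] [cite: KeevashLifshitz2023, Thm. 1.8] [cite: KupavskiiZakharov2022, §2] [cite: Grigoriev2001, Lemma 1.4 (PDF p. 8)] -/
theorem value_add_tight_abs_le_of_spread {τ : ℝ} (hτ : 1 ≤ τ) :
    ∃ c₀ : ℝ, 0 < c₀ ∧ c₀ ≤ 1 ∧ ∃ n₁ : ℕ, ∀ (n c' T D : ℕ) (Bv : ℝ) (C : Finset ℕ) (w : ℕ → ℝ), n₁ ≤ n → Even n →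
      IsExactDesign n (2 * c' + 1) T D Bv C w → n ≤ 5 * (2 * c' + 1) → D + 2 ≤ 2 * c' → D ≤ 2 * (dq n + 8) → 14 * D ≤ n →
      ∀ (X : Finset (Finset (Fin n))), X ⊆ univ.powersetCard (2 * c' + 1) →
      ∀ (Y : Finset (PMatch n)), IsRelHomogeneous τ (perfectMatchings (univ : Finset (Fin n))) (Y.image Subtype.val) →
      Real.exp (-(c₀ * dq n)) ≤ (X.card : ℝ) / (n.choose (2 * c' + 1) : ℝ) →
      Real.exp (-(c₀ * dq n)) ≤ (Y.card : ℝ) / (Fintype.card (PMatch n) : ℝ) →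
        |∑ U : OddSet n, ∑ M ∈ Y, levelWeight n (2 * c' + 1) C w U M * (if U.1 ∈ X then (1 : ℝ) else 0) +
            ((((X ×ˢ Y).filter fun UM : Finset (Fin n) × PMatch n =>
                (UM.1.filter fun x => UM.2.2.partner x ∉ UM.1).card = 1).card : ℕ) : ℝ) /
              ((Fintype.card (PMatch n) : ℝ) * ((((n / 2).choose (1 + c') * (1 + c').choose c' * 2 ^ 1 : ℕ) : ℝ)))| ≤
          Bv * Real.sqrt ((∏ i ∈ range (D / 2 + 1), ((2 * i + 1 : ℝ) / ((n : ℝ) - 2 * i))) *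
              ((X.card : ℝ) / (n.choose (2 * c' + 1) : ℝ)) * ((Y.card : ℝ) / (Fintype.card (PMatch n) : ℝ))) +
            16 * (((X.card : ℝ) / (n.choose (2 * c' + 1) : ℝ)) * ((Y.card : ℝ) / (Fintype.card (PMatch n) : ℝ))) / n +
            (c' : ℝ) * Real.sqrt (((X.card : ℝ) / (n.choose (2 * c' + 1) : ℝ)) *
              ((Y.card : ℝ) / (Fintype.card (PMatch n) : ℝ)) * ∏ i ∈ range (D / 2 + 1), ((2 * i + 1 : ℝ) / ((n : ℝ) - 2 * i))) := by
  classical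
  obtain ⟨c₀, hc₀, hc₀1, n₁, hhead⟩ := head_layerBound_of_globalLevelD GlobalLevelDInequality_holds hτ
  refine ⟨c₀, hc₀, hc₀1, n₁, ?_⟩
  intro n c' T D Bv C w hn₁ hn hdes hbal hD2 hDq hDn X hX Y hhom hμ hν
  have ht2 : 2 * (2 * c' + 1) + 2 ≤ n := hdes.2.1
  have ht : 2 * (2 * c' + 1) ≤ n := by omega
  have hhomog : IsHomog (2 * c' + 1) (fun U : Finset (Fin n) => if U ∈ X then (1 : ℝ) else 0) := by
    intro S hS
    simp only
    rw [if_neg]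
    intro hSX
    exact hS (mem_powersetCard.1 (hX hSX)).2
  obtain ⟨p, hp, hpeq⟩ := exists_ladder_decomposition (by omega : 2 * (2 * c' + 1) ≤ n + 1) hhomog
  have hdec : ∀ U ∈ univ.powersetCard (2 * c' + 1),
      (if U ∈ X then (1 : ℝ) else 0) = (∑ j ∈ range (2 * c' + 1 + 1), up^[2 * c' + 1 - j] (p j)) U :=
    fun U _ => congrFun hpeq U
  obtain ⟨κ₁, hA1⟩ := exists_tightGram_classFunction (n := n) (t := 2 * c' + 1) ⟨c', rfl⟩
  refine value_add_tight_abs_le_of_layerBounds hn hdes hD2 hbal hDn (Real.sqrt_nonneg _) X hX Y p hp hdec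
    (fun κ hκ => ?_) (fun κ hκ => ?_)
  · obtain ⟨hκ1, hκD⟩ := mem_Icc.1 hκ
    exact hhead n c' hn₁ hn ht hbal X hX p hp hdec Y hhom hμ hν κ hκ1 (by omega) (by omega)
  · obtain ⟨hκ1, hκc⟩ := mem_Icc.1 hκ
    exact tail_term_le hn ht hκc hκ1 X hX Y p hp hdec κ₁ hA1

end Summit.PneNP.PneNP.Theorems.ChebyshevTracialDesignVirtualEqualsTight
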